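import Literature.NumberTheory.DiophantineGeometry.AbcShapeGeometrySets

-- Summit.ABC.ABC is the mandated summit-side namespace (single-conjunct summit); the lakefile sets the same option tree-wide.
set_option linter.dupNamespace false

/-!
# The linear ratio energy bound (crux stmt-ABC-2757, line `critical-kloosterman-powerful-moduli`, stub `de_linRatioEnergy_le`)

Stub W1 ("linear ratio energy") of the DE counting tool (ratio Cauchy–Schwarz modulo a power
modulus `q` plus a multiplicative energy bound) for the shape count of abc triples, crux
`Summit.ABC.ABC.Theses.TwistAmplification.MazurKaneLaw`.  After Cauchy–Schwarz one factor is the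
*linear ratio energy*

`E = #{((y₀, z₀), (y₀', z₀')) ∈ ([Y₀, 2Y₀) × [Z₀, 2Z₀))² : y₀ z₀' ≡ y₀' z₀ (mod q)}`,

and `Summit.ABC.ABC.Theorems.MazurKaneLaw.de_linRatioEnergy_le` bounds it by
`Dτ · 4Y₀Z₀ · (8Y₀Z₀/q + 3)` whenever `τ(m) ≤ Dτ` for all `0 < m ≤ 4Y₀Z₀`.

Proof (elementary, folklore): fix `(z₀, y₀')` (`Z₀Y₀` choices) and the value `w = y₀ z₀'`;
then `0 < w < 4Y₀Z₀` lies in the residue class of `y₀' z₀` modulo `q` (at most `4Y₀Z₀/q + 1`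
values, `de_card_range_filter_mod_le`), and `(y₀, z₀') ↦ y₀` injects the pairs with
`y₀ z₀' = w` into the divisors of `w` (at most `τ(w) ≤ Dτ` of them,
`de_card_filter_prodEq_le_card_divisors`).  Hence `E ≤ Dτ · (4Y₀Z₀/q + 1) · Z₀Y₀`
(`de_linRatioEnergy_le_nat`), which is pushed to `ℝ` with `Nat.cast_div_le`.
-/

namespace Summit.ABC.ABC.Theorems.MazurKaneLaw

open Finset

/-- Residue classes in an initial segment: `#{w < N : w % q = r} ≤ N / q + 1`, by injecting
`w ↦ w / q` into `range (N / q + 1)`. [folklore] -/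
theorem de_card_range_filter_mod_le (N q r : ℕ) :
    ((Finset.range N).filter (fun w => w % q = r)).card ≤ N / q + 1 := by
  refine (Finset.card_le_card_of_injOn (t := Finset.range (N / q + 1)) (fun w => w / q) ?_
    ?_).trans_eq (Finset.card_range _)
  · intro w hw
    have hw' := (Finset.mem_filter.mp (Finset.mem_coe.mp hw)).1
    rw [Finset.mem_range] at hw'
    rw [Finset.mem_coe, Finset.mem_range]
    exact Nat.lt_succ_of_le (Nat.div_le_div_right hw'.le)
  · intro w₁ hw₁ w₂ hw₂ h
    have h₁ : w₁ % q = r := (Finset.mem_filter.mp (Finset.mem_coe.mp hw₁)).2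
    have h₂ : w₂ % q = r := (Finset.mem_filter.mp (Finset.mem_coe.mp hw₂)).2
    have h' : w₁ / q = w₂ / q := h
    calc w₁ = q * (w₁ / q) + w₁ % q := (Nat.div_add_mod w₁ q).symm
      _ = q * (w₂ / q) + w₂ % q := by rw [h', h₁, h₂]
      _ = w₂ := Nat.div_add_mod w₂ q

/-- Triples `((z₀, y₀'), w)` with `(z₀, y₀') ∈ B`, `w < N` and `w ≡ y₀' z₀ (mod q)` number at most
`(N / q + 1) · #B` (fibre over `(z₀, y₀')` and `de_card_range_filter_mod_le`). [folklore] -/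
theorem de_card_prod_range_filter_mod_le (q N : ℕ) (B : Finset (ℕ × ℕ)) :
    ((B ×ˢ Finset.range N).filter
        (fun t : (ℕ × ℕ) × ℕ => t.2 % q = (t.1.2 * t.1.1) % q)).card ≤ (N / q + 1) * B.card := by
  refine Finset.card_le_mul_card_image_of_maps_to (f := fun t : (ℕ × ℕ) × ℕ => t.1) ?_ _ ?_
  · intro t ht
    exact (Finset.mem_product.mp (Finset.mem_filter.mp ht).1).1
  · intro c _hc
    calc _ ≤ ((Finset.range N).filter (fun w => w % q = (c.2 * c.1) % q)).card := by
          refine Finset.card_le_card_of_injOn (fun t : (ℕ × ℕ) × ℕ => t.2) ?_ ?_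
          · intro t ht
            simp only [Finset.mem_coe, Finset.mem_filter, Finset.mem_product] at ht
            rw [Finset.mem_coe, Finset.mem_filter]
            refine ⟨ht.1.1.2, ?_⟩
            have hmod : t.2 % q = (t.1.2 * t.1.1) % q := ht.1.2
            rw [hmod, ht.2]
          · intro t₁ ht₁ t₂ ht₂ h
            simp only [Finset.mem_coe, Finset.mem_filter] at ht₁ ht₂
            have h' : t₁.2 = t₂.2 := h
            exact Prod.ext (ht₁.2.trans ht₂.2.symm) h'
      _ ≤ N / q + 1 := de_card_range_filter_mod_le N q _

/-- Quadruples `((y₀, z₀), (y₀', z₀'))` with prescribed `(z₀, y₀')` and prescribed product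
`w = y₀ z₀' ≠ 0` inject into the divisors of `w` via `y₀`. [folklore] -/
theorem de_card_filter_prodEq_le_card_divisors (S : Finset ((ℕ × ℕ) × (ℕ × ℕ)))
    (b : (ℕ × ℕ) × ℕ) (hb : b.2 ≠ 0) :
    (S.filter (fun p : (ℕ × ℕ) × (ℕ × ℕ) => ((p.1.2, p.2.1), p.1.1 * p.2.2) = b)).card ≤
      b.2.divisors.card := by
  refine Finset.card_le_card_of_injOn (fun p : (ℕ × ℕ) × (ℕ × ℕ) => p.1.1) ?_ ?_
  · intro p hp
    have e : ((p.1.2, p.2.1), p.1.1 * p.2.2) = b :=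
      (Finset.mem_filter.mp (Finset.mem_coe.mp hp)).2
    have hw : p.1.1 * p.2.2 = b.2 := congrArg Prod.snd e
    rw [Finset.mem_coe, Nat.mem_divisors]
    exact ⟨⟨p.2.2, hw.symm⟩, hb⟩
  · intro p hp p' hp' h
    have e : ((p.1.2, p.2.1), p.1.1 * p.2.2) = b :=
      (Finset.mem_filter.mp (Finset.mem_coe.mp hp)).2
    have e' : ((p'.1.2, p'.2.1), p'.1.1 * p'.2.2) = b :=
      (Finset.mem_filter.mp (Finset.mem_coe.mp hp')).2
    have h' : p.1.1 = p'.1.1 := h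
    have hw : p.1.1 * p.2.2 = b.2 := congrArg Prod.snd e
    have ee := e.trans e'.symm
    simp only [Prod.mk.injEq] at ee
    obtain ⟨⟨h12, h21⟩, hprod⟩ := ee
    have hpos : 0 < p.1.1 := by
      refine Nat.pos_of_ne_zero (fun h0 => hb ?_)
      rw [← hw, h0, Nat.zero_mul]
    have e3 : p.2.2 = p'.2.2 := by
      apply Nat.eq_of_mul_eq_mul_left hpos
      rw [hprod, h']
    exact Prod.ext (Prod.ext h' h12) (Prod.ext h21 e3)

/-- The linear ratio energy bound in `ℕ`:
`E ≤ Dτ · ((4Y₀Z₀ / q + 1) · Z₀Y₀)` (natural division). [folklore] -/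
theorem de_linRatioEnergy_le_nat (q Y₀ Z₀ Dτ : ℕ)
    (hτ : ∀ m : ℕ, m ≠ 0 → m ≤ 4 * (Y₀ * Z₀) → m.divisors.card ≤ Dτ) :
    (((Finset.Ico Y₀ (2 * Y₀) ×ˢ Finset.Ico Z₀ (2 * Z₀)) ×ˢ
        (Finset.Ico Y₀ (2 * Y₀) ×ˢ Finset.Ico Z₀ (2 * Z₀))).filter
      (fun p : (ℕ × ℕ) × (ℕ × ℕ) =>
        (q : ℤ) ∣ ((p.1.1 * p.2.2 : ℕ) : ℤ) - ((p.2.1 * p.1.2 : ℕ) : ℤ))).card ≤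
      Dτ * ((4 * (Y₀ * Z₀) / q + 1) * (Z₀ * Y₀)) := by
  set S := (((Finset.Ico Y₀ (2 * Y₀) ×ˢ Finset.Ico Z₀ (2 * Z₀)) ×ˢ
        (Finset.Ico Y₀ (2 * Y₀) ×ˢ Finset.Ico Z₀ (2 * Z₀))).filter
      (fun p : (ℕ × ℕ) × (ℕ × ℕ) =>
        (q : ℤ) ∣ ((p.1.1 * p.2.2 : ℕ) : ℤ) - ((p.2.1 * p.1.2 : ℕ) : ℤ))) with hS
  -- What membership in `S` says about a quadruple `p = ((y₀, z₀), (y₀', z₀'))`.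
  have hmem : ∀ p ∈ S, ((Y₀ ≤ p.1.1 ∧ p.1.1 < 2 * Y₀) ∧ (Z₀ ≤ p.1.2 ∧ p.1.2 < 2 * Z₀)) ∧
      ((Y₀ ≤ p.2.1 ∧ p.2.1 < 2 * Y₀) ∧ (Z₀ ≤ p.2.2 ∧ p.2.2 < 2 * Z₀)) ∧
      (p.1.1 * p.2.2) % q = (p.2.1 * p.1.2) % q := by
    intro p hp
    rw [hS, Finset.mem_filter] at hp
    simp only [Finset.mem_product, Finset.mem_Ico] at hp
    exact ⟨hp.1.1, hp.1.2, (Nat.modEq_iff_dvd.mpr hp.2).symm⟩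
  -- Step 1: fibres of `p ↦ ((z₀, y₀'), y₀ z₀')` have at most `Dτ` elements.
  have h1 : S.card ≤ Dτ *
      (S.image (fun p : (ℕ × ℕ) × (ℕ × ℕ) => ((p.1.2, p.2.1), p.1.1 * p.2.2))).card := by
    refine Finset.card_le_mul_card_image S Dτ ?_
    intro b hb
    obtain ⟨p, hp, rfl⟩ := Finset.mem_image.mp hb
    obtain ⟨⟨⟨hy1, hy2⟩, -, -⟩, ⟨⟨-, -⟩, hz1, hz2⟩, -⟩ := hmem p hp
    have hy : 0 < p.1.1 := by omega
    have hz : 0 < p.2.2 := by omega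
    have hw0 : p.1.1 * p.2.2 ≠ 0 := Nat.mul_ne_zero hy.ne' hz.ne'
    have hwN : p.1.1 * p.2.2 ≤ 4 * (Y₀ * Z₀) := by
      calc p.1.1 * p.2.2 ≤ (2 * Y₀) * (2 * Z₀) := Nat.mul_le_mul hy2.le hz2.le
        _ = 4 * (Y₀ * Z₀) := by ring
    exact (de_card_filter_prodEq_le_card_divisors S ((p.1.2, p.2.1), p.1.1 * p.2.2) hw0).trans
      (hτ _ hw0 hwN)
  -- Step 2: the image lies in the triples `((z₀, y₀'), w)`, `w < 4Y₀Z₀`, `w ≡ y₀' z₀ (mod q)`.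
  have h2 : S.image (fun p : (ℕ × ℕ) × (ℕ × ℕ) => ((p.1.2, p.2.1), p.1.1 * p.2.2)) ⊆
      ((Finset.Ico Z₀ (2 * Z₀) ×ˢ Finset.Ico Y₀ (2 * Y₀)) ×ˢ Finset.range (4 * (Y₀ * Z₀))).filter
        (fun t : (ℕ × ℕ) × ℕ => t.2 % q = (t.1.2 * t.1.1) % q) := by
    intro b hb
    obtain ⟨p, hp, rfl⟩ := Finset.mem_image.mp hb
    obtain ⟨⟨⟨_, hy2⟩, hz1, hz2⟩, ⟨⟨hy1', hy2'⟩, _, hz2'⟩, hmod⟩ := hmem p hp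
    simp only [Finset.mem_filter, Finset.mem_product, Finset.mem_Ico, Finset.mem_range]
    refine ⟨⟨⟨⟨hz1, hz2⟩, hy1', hy2'⟩, ?_⟩, hmod⟩
    calc p.1.1 * p.2.2 < (2 * Y₀) * (2 * Z₀) := Nat.mul_lt_mul_of_lt_of_lt hy2 hz2'
      _ = 4 * (Y₀ * Z₀) := by ring
  -- Step 3: count those triples.
  have h3 := de_card_prod_range_filter_mod_le q (4 * (Y₀ * Z₀))
    (Finset.Ico Z₀ (2 * Z₀) ×ˢ Finset.Ico Y₀ (2 * Y₀))
  have hcard : (Finset.Ico Z₀ (2 * Z₀) ×ˢ Finset.Ico Y₀ (2 * Y₀)).card = Z₀ * Y₀ := by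
    have eZ : 2 * Z₀ - Z₀ = Z₀ := by omega
    have eY : 2 * Y₀ - Y₀ = Y₀ := by omega
    rw [Finset.card_product, Nat.card_Ico, Nat.card_Ico, eZ, eY]
  rw [hcard] at h3
  calc S.card ≤ _ := h1
    _ ≤ Dτ * _ := Nat.mul_le_mul_left _ (Finset.card_le_card h2)
    _ ≤ Dτ * ((4 * (Y₀ * Z₀) / q + 1) * (Z₀ * Y₀)) := Nat.mul_le_mul_left _ h3

/-- **Linear ratio energy** (stub W1 of the DE tool, crux stmt-ABC-2757): the number of
`((y₀, z₀), (y₀', z₀')) ∈ ([Y₀, 2Y₀) × [Z₀, 2Z₀))²` with `y₀ z₀' ≡ y₀' z₀ (mod q)` is at most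
`Dτ · 4Y₀Z₀ · (8Y₀Z₀/q + 3)` once `τ(m) ≤ Dτ` for `0 < m ≤ 4Y₀Z₀`. [folklore] -/
theorem de_linRatioEnergy_le : ∀ (q Y₀ Z₀ Dτ : ℕ), 0 < q → (∀ m : ℕ, m ≠ 0 → m ≤ 4 * (Y₀ * Z₀) → m.divisors.card ≤ Dτ) → ((((Finset.Ico Y₀ (2 * Y₀) ×ˢ Finset.Ico Z₀ (2 * Z₀)) ×ˢ (Finset.Ico Y₀ (2 * Y₀) ×ˢ Finset.Ico Z₀ (2 * Z₀))).filter (fun p : (ℕ × ℕ) × (ℕ × ℕ) => (q : ℤ) ∣ ((p.1.1 * p.2.2 : ℕ) : ℤ) - ((p.2.1 * p.1.2 : ℕ) : ℤ))).card : ℝ) ≤ (Dτ : ℝ) * (4 * ((Y₀ : ℝ) * Z₀)) * (8 * ((Y₀ : ℝ) * Z₀) / q + 3) := by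
  intro q Y₀ Z₀ Dτ _ hτ
  have hnat := de_linRatioEnergy_le_nat q Y₀ Z₀ Dτ hτ
  have hK : ((4 * (Y₀ * Z₀) / q : ℕ) : ℝ) ≤ 4 * ((Y₀ : ℝ) * Z₀) / q := by
    calc ((4 * (Y₀ * Z₀) / q : ℕ) : ℝ) ≤ ((4 * (Y₀ * Z₀) : ℕ) : ℝ) / q := Nat.cast_div_le
      _ = 4 * ((Y₀ : ℝ) * Z₀) / q := by push_cast; ring
  have hYZ : (0 : ℝ) ≤ 4 * ((Y₀ : ℝ) * Z₀) / q := by positivity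
  have hfin : ((4 * (Y₀ * Z₀) / q : ℕ) : ℝ) + 1 ≤ 4 * (8 * ((Y₀ : ℝ) * Z₀) / q + 3) := by
    have e : 4 * (8 * ((Y₀ : ℝ) * Z₀) / q + 3) = 8 * (4 * ((Y₀ : ℝ) * Z₀) / q) + 12 := by ring
    rw [e]
    linarith
  have hDZY : (0 : ℝ) ≤ (Dτ : ℝ) * ((Z₀ : ℝ) * Y₀) := by positivity
  calc _ ≤ ((Dτ * ((4 * (Y₀ * Z₀) / q + 1) * (Z₀ * Y₀)) : ℕ) : ℝ) := Nat.cast_le.mpr hnat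
    _ = (Dτ : ℝ) * ((Z₀ : ℝ) * Y₀) * (((4 * (Y₀ * Z₀) / q : ℕ) : ℝ) + 1) := by push_cast; ring
    _ ≤ (Dτ : ℝ) * ((Z₀ : ℝ) * Y₀) * (4 * (8 * ((Y₀ : ℝ) * Z₀) / q + 3)) :=
        mul_le_mul_of_nonneg_left hfin hDZY
    _ = (Dτ : ℝ) * (4 * ((Y₀ : ℝ) * Z₀)) * (8 * ((Y₀ : ℝ) * Z₀) / q + 3) := by ring

end Summit.ABC.ABC.Theorems.MazurKaneLaw
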